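import Literature.Probability.FitznerVanDerHofstad2017.NobleBoundsN1ClassTools
import Literature.Probability.FitznerVanDerHofstad2017.NobleBoundsN1Classes
import Literature.Probability.FitznerVanDerHofstad2017.NobleJointTwoLevel
import HarnessLib

/-!
# Fitzner–van der Hofstad (2017), §6.1 — the class `(a,b) = (0,0)` of the bound (6.4) at `N = 1`, PROVED

[FvdH17] = R. Fitzner, R. van der Hofstad, *Mean-field behavior for nearest-neighbor percolation in `d > 10`*,
Electron. J. Probab. **22** (2017), no. 43; extended version arXiv:1506.07977v2 (v2 p. 59, TeX source
`PercPaper_arxiv2017.tex` l.9903–9906, label `Bound-Xi-case-abZero`):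

  "**Case `a = 0, b = 0`.** We begin with the simplest case. We use `u + e_ι ≠ z = t` and `u = w = b̲ ≠ z` to
  conclude `𝓣_{1̲,1,1}(e_ι, t−u, 0) = Ā^{ι,0,0}(u,u,t,t)`." (6.7)

together with "Case `a = 0`. In this case `w = u`. If `0 = w = u`, then the left triangle shrinks to a point,
otherwise `0` and `w` are doubly connected: `δ_{u,w} ℙ(0 ⇔ w) = P^{S,0}(u,w)`" (l.9880–9884) and "the right
triangle `z,t,x` is bounded by `P^{E,b}(t−x,z−x)`" (l.9893).

## What is proved

`jointWit_cls_0_0` — the instance `(a,b) = (0,0)` of the hypothesis `h2` of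
`NobleBoundsN1Classes.nobleXiT_one_le_blocks_of_cls` for the joint two-level event of `NobleJointTwoLevel`:

  `J(v−u) · ℙ_p^{⊗2}(jointWit u v w z t x ∩ class (0,0))`
  `  ≤ Σ_ι 𝟙{v = u + e_ι} P^{S,0}(u,w) Ā'^{ι,0,0}(u,w,t,z) P^{E,0}(t−x,z−x)`

over the percolation letters `Letters.perc d p` and the PRIMED row `(0,0)` of `NobleBlocksPrime` (= the §6.1
display (6.7); App. B prints the transposed index order, DIVERGENCE D74 (i) of the b2b-lace packet).

Proof = the printed three-piece argument, witness by witness: on the class, `w = u` and `z = t`; the factor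
`p = J(b₀)` is absorbed as the line `{u ←1̲→ u+e_ι}` witnessed by `b₀` on level `0`
(`NobleBoundsN1ClassTools.ofReal_mul_piPerc_preimage_eraseAt0`; `jointWit` does not read that coordinate);
the witnesses of `jointWit` are regrouped as LEFT = `{0↔u}₀, {0↔w}₀` (same configuration: `ℙ(0 ⇔ u)`),
MIDDLE = `{u ←1̲→ u+e_ι}₀ ⊛ {u+e_ι ←1→ t}₁ ⊛ {t ←1→ u}₀` (the level-`1` witness of `{b̄₀ ↔ t}` is bond-disjoint from
the level-`0` witnesses — the clause "all connections are bond-disjoint" of Fig. 12 — so this IS a generalized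
disjoint occurrence, Def. 4.1, bounded by the repulsive `𝓣_{1̲,1,1}(e_ι,t−u,0)` through
`NoblePercLettersTransport`), RIGHT = `{t↔x}₁, {z↔x}₁` (`ℙ(0 ⇔ t−x)`); the three groups are separated by the
GROUPED BK inequality `LabelledDisjointOccurrenceGrouped.pi_genDisjOccGrouped_le_prod`.  No hypothesis beyond the
displayed objects; no numeral; no dimension.
-/

namespace Literature.Probability.FitznerVanDerHofstad2017

open Literature.Barriers.CriticalPhenomena Literature.Probability.Percolation Literature.Probability.LatticeModels
open Literature.Probability.FitznerVanDerHofstad2017.NobleBlocks MeasureTheory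
open Literature.Probability.FitznerVanDerHofstad2017.NobleBlocks.LenIdx
open scoped ENNReal BigOperators

variable {d : ℕ}

/-! ### Shared by all nine classes -/

/-- `jointWit` does not read the coordinate `b₀ = (u,v)` of level `0` (its level-`0` witnesses live in
`ω₀ ∖ {b₀}`). [cite: FitznerVanDerHofstad2017, (4.57) (arXiv:1506.07977v2 p. 41)] -/
theorem eraseAt0_preimage_jointWit (u v w z t x : Site d) :
    eraseAt0 s(u, v) ⁻¹' jointWit u v w z t x = jointWit u v w z t x := by
  ext ω
  simp only [Set.mem_preimage, mem_jointWit_iff, eraseAt0_apply_zero, eraseAt0_apply_one, offBonds_def,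
    sdiff_idem]

/-- On `jointWit` every class `(a,b)` is insensitive to the coordinate `b₀ = (u,v)` of level `0` as well: the
class of `{u ↔ w}` reads the bond `(u,w) ≠ b₀` (`w ≠ b̄₀` on `jointWit`), the class of `{t ↔ z}` reads level `1`.
[cite: FitznerVanDerHofstad2017, §6.1 "Case a = 0 / 1 / 2" (arXiv:1506.07977v2 pp. 58–59)] -/
theorem eraseAt0_preimage_jointWit_inter_clsSet (u v w z t x : Site d) (a b : Fin 3) :
    eraseAt0 s(u, v) ⁻¹' (jointWit u v w z t x ∩ clsSet u w t z a b) = jointWit u v w z t x ∩ clsSet u w t z a b := by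
  ext ω
  have hj : eraseAt0 s(u, v) ω ∈ jointWit u v w z t x ↔ ω ∈ jointWit u v w z t x :=
    Set.ext_iff.1 (eraseAt0_preimage_jointWit u v w z t x) ω
  have hb : eraseAt0 s(u, v) ω ∈ lineCls t z 1 b ↔ ω ∈ lineCls t z 1 b := by
    rcases b with ⟨_ | _ | _ | n, hb⟩
    · exact Iff.rfl
    · exact Iff.rfl
    · exact Iff.rfl
    · exact absurd hb (by omega)
  have hsw : ∀ {w' : Site d}, w' ≠ v → (s(u, w') ∈ ω 0 \ {s(u, v)} ↔ s(u, w') ∈ ω 0) := fun {w'} hw' =>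
    ⟨fun h => h.1, fun h => ⟨h, fun h' => hw' (Sym2.congr_right.1 h')⟩⟩
  have ha : ω ∈ jointWit u v w z t x → (eraseAt0 s(u, v) ω ∈ lineCls u w 0 a ↔ ω ∈ lineCls u w 0 a) := by
    intro hω
    have hwv : w ≠ v := ((mem_jointWit_iff u v w z t x ω).1 hω).1.2.2.1
    rcases a with ⟨_ | _ | _ | n, ha⟩
    · exact Iff.rfl
    · show u ≠ w ∧ s(u, w) ∈ ω 0 \ {s(u, v)} ↔ u ≠ w ∧ s(u, w) ∈ ω 0
      rw [hsw hwv]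
    · show u ≠ w ∧ s(u, w) ∉ ω 0 \ {s(u, v)} ↔ u ≠ w ∧ s(u, w) ∉ ω 0
      rw [hsw hwv]
    · exact absurd ha (by omega)
  simp only [Set.mem_preimage, Set.mem_inter_iff, mem_clsSet_iff]
  constructor
  · rintro ⟨hω, h1, h2⟩
    exact ⟨hj.1 hω, (ha (hj.1 hω)).1 h1, hb.1 h2⟩
  · rintro ⟨hω, h1, h2⟩
    exact ⟨hj.2 hω, (ha hω).2 h1, hb.2 h2⟩

/-- The level-`0` witness pool `K₀ 0, …, K₀ 3, {b₀}` of a point of `jointWit ∩ {b₀ ∈ ω₀}` is pairwise disjoint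
(the `K₀ j` live in `ω₀ ∖ {b₀}`). [cite: FitznerVanDerHofstad2017, (4.57) (arXiv:1506.07977v2 p. 41)] -/
theorem pairwise_disjoint_pool₀ {K₀ : Fin 4 → Set (Sym2 (Site d))} {e : Sym2 (Site d)}
    (hd₀ : Pairwise fun i j => Disjoint (K₀ i) (K₀ j)) (he : ∀ j, Disjoint (K₀ j) {e}) :
    Pairwise fun a a' => Disjoint (Sum.elim K₀ ![({e} : Set (Sym2 (Site d)))] a) (Sum.elim K₀ ![{e}] a') := by
  rintro (a | a) (a' | a') hne
  · exact hd₀ fun h => hne (by rw [h])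
  · fin_cases a'; exact he a
  · fin_cases a; exact (he a').symm
  · fin_cases a; fin_cases a'; exact absurd rfl hne

/-- Pairwise disjointness of a family of three sets from the three pairs. [folklore] -/
theorem pairwise_disjoint_vec3 {α : Type*} {a b c : Set α} (h01 : Disjoint a b) (h02 : Disjoint a c)
    (h12 : Disjoint b c) : Pairwise fun i j => Disjoint (![a, b, c] i) (![a, b, c] j) := by
  intro i j hij
  fin_cases i <;> fin_cases j <;> simp at hij ⊢ <;>
    first | assumption | exact Disjoint.symm ‹_›

/-- The bond factor: `J(v − u) = p 𝟙{v − u = e_ι for some ι}`; if `v − u` is not a unit step the class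
estimate is trivial. [cite: HeydenreichVanDerHofstad2017, (6.2.1)] -/
theorem ofReal_bondJ_eq_zero_of_not_adj (p : unitInterval) {u v : Site d} (h : ¬ (zdGraph d).Adj 0 (v - u)) :
    ENNReal.ofReal (bondJ d p (v - u)) = 0 := by
  rw [bondJ_def, if_neg h, ENNReal.ofReal_zero]

/-- A single term is below the `ι`-sum (all terms are non-negative). [folklore] -/
theorem term_le_sum_ite (ι₀ : Fin d × Bool) {u v : Site d} (hv : v = u + stepVec ι₀)
    (B : Fin d × Bool → ℝ≥0∞) :
    B ι₀ ≤ ∑ ι : Fin d × Bool, (if v = u + stepVec ι then (1 : ℝ≥0∞) else 0) * B ι := by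
  have h := Finset.single_le_sum (f := fun ι => (if v = u + stepVec ι then (1 : ℝ≥0∞) else 0) * B ι)
    (fun _ _ => zero_le) (Finset.mem_univ ι₀)
  simp only [if_pos hv, one_mul] at h
  exact h

/-! ### The class `(0,0)` -/

/-- Bookkeeping of the regrouping for the class `(0,0)`: which pool member serves which line.
Lines: LEFT `![{0↔u}₀, {0↔w}₀]`, MIDDLE `![{u ←1̲→ v}₀, {v ←1→ t}₁, {t ←1→ u}₀]`, RIGHT `![{x↔t}₁, {x↔t}₁]`;
pools: level `0` = `![K₀ 0, K₀ 1, K₀ 3, {b₀}]`, repulsive level `1` = `![K₁ 0]`, free level `1` = `![K₁ 2, K₁ 3]`.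
[folklore] -/
def src00 : Fin 2 ⊕ (Fin 3 ⊕ Fin 2) → Fin 4 ⊕ (Fin 1 ⊕ Fin 2) :=
  Sum.elim ![Sum.inl 0, Sum.inl 1]
    (Sum.elim ![Sum.inl 3, Sum.inr (Sum.inl 0), Sum.inl 2] ![Sum.inr (Sum.inr 0), Sum.inr (Sum.inr 1)])

/-- **[FvdH17] §6.1, Case `a = 0, b = 0` of (6.4) at `N = 1`.**
`J(v−u) ℙ_p^{⊗2}(jointWit u v w z t x ∩ class (0,0)) ≤ Σ_ι 𝟙{v = u+e_ι} P^{S,0}(u,w) Ā'^{ι,0,0}(u,w,t,z) P^{E,0}(t−x,z−x)`.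
[cite: FitznerVanDerHofstad2017, §6.1 (Bound-Xi-case-abZero) = (6.7) and "Case a = 0" (arXiv:1506.07977v2 pp. 58–59)] -/
theorem jointWit_cls_0_0 (p : unitInterval) (x u v w z t : Site d) :
    ENNReal.ofReal (bondJ d p (v - u)) * piPerc d p 2 (jointWit u v w z t x ∩ clsSet u w t z 0 0) ≤
      ∑ ι : Fin d × Bool, (if v = u + stepVec ι then (1 : ℝ≥0∞) else 0) *
        (blockPS (Letters.perc d p) 0 u w * blockAbar' (Letters.perc d p) ι 0 0 u w t z *
          blockPE (Letters.perc d p) 0 (t - x) (z - x)) := by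
  classical
  set F := jointWit u v w z t x ∩ clsSet u w t z 0 0 with hF
  -- the bond factor `J(v - u)`
  by_cases hadj : (zdGraph d).Adj 0 (v - u)
  swap
  · rw [ofReal_bondJ_eq_zero_of_not_adj p hadj, zero_mul]; exact zero_le
  obtain ⟨ι₀, hι₀⟩ := (zdGraph_adj_iff_stepVec 0 (v - u)).1 hadj
  have hv : v = u + stepVec ι₀ := by rw [zero_add] at hι₀; exact sub_eq_iff_eq_add'.1 hι₀
  have huv : u ≠ v := by rintro rfl; rw [sub_self] at hadj; exact hadj.ne rfl
  have he : s(u, v) ∈ (zdGraph d).edgeSet :=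
    (SimpleGraph.mem_edgeSet _).2 ((zdGraph_adj_iff_stepVec u v).2 ⟨ι₀, hv⟩)
  rw [bondJ_def, if_pos hadj]
  -- an empty class contributes nothing; otherwise read off the side conditions
  by_cases hne : F.Nonempty
  swap
  · rw [Set.not_nonempty_iff_eq_empty.1 hne, measure_empty, mul_zero]; exact zero_le
  obtain ⟨ω₀, hjw₀, hcls₀⟩ := hne
  obtain ⟨⟨-, -, -, hzv, htu, -, -⟩, -⟩ := (mem_jointWit_iff u v w z t x ω₀).1 hjw₀
  have hwu : u = w := (mem_lineCls_zero_iff u w 0 ω₀).1 hcls₀.1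
  have hzt : t = z := (mem_lineCls_zero_iff t z 1 ω₀).1 hcls₀.2
  have htv : t ≠ v := fun h => hzv (hzt ▸ h)
  have hvt : v ≠ t := fun h => htv h.symm
  -- the `ι`-sum is at least its `ι₀` term
  refine le_trans ?_ (term_le_sum_ite ι₀ hv _)
  -- absorb `p` as the open bond `b₀` on level `0`
  have hFm : MeasurableSet F := (measurableSet_jointWit u v w z t x).inter (measurableSet_clsSet u w t z 0 0)
  have habs := ofReal_mul_piPerc_preimage_eraseAt0 p he hFm
  rw [hF, eraseAt0_preimage_jointWit_inter_clsSet, ← hF] at habs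
  rw [habs]
  -- the regrouped line families
  set AS : Fin 2 → Set (BondConfig (Site d)) := ![event (ge 0) 0 u, event (ge 0) 0 u] with hAS
  set AM : Fin 3 → Set (BondConfig (Site d)) := ![event (eq 1) u v, event (ge 1) v t, event (ge 1) t u] with hAM
  set AE : Fin 2 → Set (BondConfig (Site d)) := ![event (ge 0) x t, event (ge 0) x t] with hAE
  set cS : Fin 2 → Fin 2 := ![0, 0] with hcS
  set cM : Fin 3 → Fin 2 := ![0, 1, 0] with hcM
  set cE : Fin 2 → Fin 2 := ![1, 1] with hcE
  -- witness-level inclusion into the grouped event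
  have hincl : {ω : Fin 2 → BondConfig (Site d) | s(u, v) ∈ ω 0} ∩ F ⊆
      genDisjOccGrouped (Sum.elim AS (Sum.elim AM AE)) (Sum.elim cS (Sum.elim cM cE)) tag3 := by
    rintro ω ⟨hb0, hjw, -⟩
    obtain ⟨-, K₀, K₁, h₀, h₁, hA₀, hA₁, hd₀, hd₁, hc₀, -, -⟩ := (mem_jointWit_iff u v w z t x ω).1 hjw
    have hK₀ω : ∀ j, K₀ j ⊆ ω 0 := fun j => (h₀ j).trans (offBonds_subset _ _)
    have hK₁ω : ∀ j, K₁ j ⊆ ω 1 := fun j => (h₁ j).trans (offBonds_subset _ _)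
    have hb₀K₀ : ∀ j, Disjoint (K₀ j) {s(u, v)} := fun j => Set.disjoint_singleton_right.2 fun h => by
      have h' := h₀ j h; rw [offBonds_def] at h'; exact h'.2 rfl
    have hb₀K₁ : ∀ j, Disjoint ({s(u, v)} : Set (Sym2 (Site d))) (K₁ j) := fun j =>
      Set.disjoint_singleton_left.2 fun h => by
        have h' := h₁ j h; rw [offBonds_def] at h'
        exact h'.2 ((mem_bondsAt_singleton_iff u _).2 (Sym2.mem_mk_left u v))
    have hK00 : K₀ 0 ∈ (openConn 0 u : Set (BondConfig (Site d))) := hA₀ 0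
    have hK01 : K₀ 1 ∈ (openConn 0 w : Set (BondConfig (Site d))) := hA₀ 1
    have hK03 : K₀ 3 ∈ (openConn w z : Set (BondConfig (Site d))) := hA₀ 3
    have hK10 : K₁ 0 ∈ (openConn v t : Set (BondConfig (Site d))) := hA₁ 0
    have hK12 : K₁ 2 ∈ (openConn t x : Set (BondConfig (Site d))) := hA₁ 2
    have hK13 : K₁ 3 ∈ (openConn z x : Set (BondConfig (Site d))) := hA₁ 3
    have hK03' : K₀ 3 ∈ (openConn t u : Set (BondConfig (Site d))) := by
      have h : K₀ 3 ∈ (openConn u t : Set (BondConfig (Site d))) := by rw [hwu, hzt]; exact hK03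
      exact SimpleGraph.Reachable.symm h
    refine mem_genDisjOccGrouped_of_pools₃ _ _ _ ω ![K₀ 0, K₀ 1, K₀ 3, {s(u, v)}] ![K₁ 0] ![K₁ 2, K₁ 3]
      ?_ ?_ ?_ ?_ ?_ ?_ src00 (by decide) ?_ ?_ (by decide)
    · intro a; fin_cases a
      · exact hK₀ω 0
      · exact hK₀ω 1
      · exact hK₀ω 3
      · exact Set.singleton_subset_iff.2 hb0
    · intro b; fin_cases b; exact hK₁ω 0
    · intro r; fin_cases r
      · exact hK₁ω 2
      · exact hK₁ω 3
    · exact pairwise_disjoint_vec4 (hd₀ (by decide)) (hd₀ (by decide)) (hb₀K₀ 0) (hd₀ (by decide))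
        (hb₀K₀ 1) (hb₀K₀ 3)
    · rintro (b | b) (b' | b') hbb' <;> fin_cases b <;> fin_cases b' <;> simp at hbb' ⊢ <;> exact hd₁ (by decide)
    · intro a b; fin_cases a <;> fin_cases b
      · exact (hc₀ 0).symm
      · exact (hc₀ 1).symm
      · exact (hc₀ 3).symm
      · exact hb₀K₁ 0
    · rintro (i | i | i) <;> fin_cases i <;> rfl
    · rintro (i | i | i) <;> fin_cases i
      · show K₀ 0 ∈ (event (ge 0) 0 u : Set (BondConfig (Site d)))
        rw [event_ge, openConnGe_zero]; exact hK00
      · show K₀ 1 ∈ (event (ge 0) 0 u : Set (BondConfig (Site d)))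
        rw [event_ge, openConnGe_zero, hwu]; exact hK01
      · show ({s(u, v)} : Set (Sym2 (Site d))) ∈ (event (eq 1) u v : Set (BondConfig (Site d)))
        rw [event_eq]; exact mem_openConnEq_one_of_mem huv (Set.mem_singleton _)
      · show K₁ 0 ∈ (event (ge 1) v t : Set (BondConfig (Site d)))
        rw [event_ge, openConnGe_one_eq hvt]; exact hK10
      · show K₀ 3 ∈ (event (ge 1) t u : Set (BondConfig (Site d)))
        rw [event_ge, openConnGe_one_eq htu]; exact hK03'
      · show K₁ 2 ∈ (event (ge 0) x t : Set (BondConfig (Site d)))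
        rw [event_ge, openConnGe_zero]; exact SimpleGraph.Reachable.symm hK12
      · show K₁ 3 ∈ (event (ge 0) x t : Set (BondConfig (Site d)))
        rw [event_ge, openConnGe_zero, hzt]; exact SimpleGraph.Reachable.symm hK13
  -- finitary lines
  have hfS : ∀ i, IsFinitary (AS i) := fun i => by
    rw [hAS]; fin_cases i; exacts [isFinitary_event (ge 0) 0 u, isFinitary_event (ge 0) 0 u]
  have hfM : ∀ i, IsFinitary (AM i) := fun i => by
    rw [hAM]; fin_cases i
    exacts [isFinitary_event (eq 1) u v, isFinitary_event (ge 1) v t, isFinitary_event (ge 1) t u]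
  have hfE : ∀ i, IsFinitary (AE i) := fun i => by
    rw [hAE]; fin_cases i; exacts [isFinitary_event (ge 0) x t, isFinitary_event (ge 0) x t]
  -- grouped BK and the three letters
  calc piPerc d p 2 ({ω : Fin 2 → BondConfig (Site d) | s(u, v) ∈ ω 0} ∩ F)
      ≤ piPerc d p 2 (genDisjOccGrouped (Sum.elim AS (Sum.elim AM AE)) (Sum.elim cS (Sum.elim cM cE)) tag3) :=
        measure_mono hincl
    _ ≤ piPerc d p 2 (genDisjOcc AS cS) * piPerc d p 2 (genDisjOcc AM cM) * piPerc d p 2 (genDisjOcc AE cE) :=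
        piPerc_genDisjOccGrouped_tag3_le p AS AM AE cS cM cE hfS hfM hfE
    _ ≤ blockPS (Letters.perc d p) 0 u w * blockAbar' (Letters.perc d p) ι₀ 0 0 u w t z *
          blockPE (Letters.perc d p) 0 (t - x) (z - x) := by
        refine mul_le_mul' (mul_le_mul' ?_ ?_) ?_
        · rw [← hwu]; exact piPerc_start_zero_le_blockPS p u cS rfl
        · exact piPerc_mid_zero_zero_le_blockAbar' p hv hwu.symm hzt.symm htu htv cM
        · exact piPerc_end_zero_le_blockPE p hzt.symm cE rfl

end Literature.Probability.FitznerVanDerHofstad2017
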